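import Mathlib
import Literature.Probability.Moments.MultilevelMonteCarloAllocation
import HarnessLib

/-!
# The work–variance product of a randomized-truncation estimator: the Cauchy–Schwarz floor, the
# optimal tail distribution (Rhee–Glynn 2015, Proposition 1) and the geometric cost class

HONEST FRAMING: exact (Metropolis-corrected) sampling algorithms for lattice gauge theory;
figures of merit are autocorrelation/cost numbers at stated couplings and volumes; no
continuum-physics claim.

Topic `Probability/Moments` (companion of `RandomizedTruncation.lean`, where the two factors are
derived: the second moment `Σ_n β_n/F_n` of the coupled-sum estimator with `F_n = P(N ≥ n)`,
`β_n = E(Y_{n−1} − Y)² − E(Y_n − Y)²` (`hasSum_integral_sumEst_sq`), and the expected work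
`Σ_n t_n F_n` (`lintegral_cost_sumEst`); sibling of `MultilevelMonteCarloAllocation.lean`, whose
Cauchy–Schwarz allocation bound `MLMC.sq_sum_sqrt_le_cost_mul_mlVar` (Giles) is the finite-horizon
step reused here — the randomized estimator's tail probabilities `F_n` play the role of Giles'
sample numbers `N_ℓ`).  PUBLISHED RESULTS, every statement proved; pure real analysis.

Sources (READ at the locators).
* C.-H. Rhee, P. W. Glynn, *Unbiased estimation with square root convergence for SDE models*,
  Oper. Res. 63 (2015) [RheeGlynn2015], Proposition 1 — formalised from the RESTATEMENT in
  C. Zheng, J. Pan, Q. Wang, *Optimal distributions for randomized unbiased estimators with an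
  infinite horizon and an adaptive algorithm*, IMA J. Numer. Anal. (2026) [arXiv:2304.07797]
  [ZhengPanWang2023]: §2, Problem (1) "To maximize the efficiency of the unbiased estimator `Z`,
  Rhee and Glynn proposed finding a distribution that minimizes the product `E(τ) × var(Z)` …
  `E(τ) = Σ_{n≥0} t_n P(N ≥ n)` … `min_F g(F) := (Σ_{n≥0} β_n/F_n)(Σ_{n≥0} t_n F_n)` s.t.
  `F_i ≥ F_{i+1}`, `F_i > 0`, `F_0 = 1`", and §4 "Proposition 1 in Rhee and Glynn implies that the
  solution … is `F̄_i = √((β_i/t_i)/(β_0/t_0))`" (valid when `β_i/t_i` is non-increasing, which is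
  what the blocks `J` of §4 enforce).  The original is cited for the result, the secondary for the
  text actually read.
* C.-H. Rhee, P. W. Glynn, *A new approach to unbiased estimation for SDE's*, WSC 2012
  [arXiv:1207.2452] [RheeGlynn2012], §2 (last paragraph): "`var Z < ∞` if `P(N ≥ i) ∼ c 2^{−γi}` …
  for `0 < γ < 2r` … In order that (3) [`Σ_i t_i P(N ≥ i)`, `t_i = 2^{i−1}`] be finite, we require
  that `γ > 1`. Consequently, a square root convergence rate is ensured when `2r > 1` (in which case
  we can, for example, choose `γ = (1+2r)/2`)."
* M. Vihola, *Unbiased estimators and multilevel Monte Carlo*, Oper. Res. 66 (2018)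
  [arXiv:1512.01022] [Vihola2018], §3 (paragraph after Remark 6): "taking `p_i ∝ 2^{−ξi}`, where
  `ξ ∈ (1, 2α∧β)` … unbiased estimators with finite variance and finite expected cost can be
  obtained".
* J. Blanchet, P. W. Glynn, Y. Pei, *Unbiased multilevel Monte Carlo: stochastic optimization,
  steady-state simulation, quantiles, and other applications* [arXiv:1904.09929]
  [BlanchetGlynnPei2019], §2 (the general principle): Assumption 1 ("`E|Δ_m|² ≤ c·2^{−(1+α)m}`",
  "`E[C_m] ≤ c'·2^m`"), `N` geometric "`p(k) = P(N = k) = r(1−r)^k`" with "`r ∈ (1/2,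
  1 − 2^{−(1+α)})`", and the two displays "`E[Z²] = Σ_k E[Δ_k²]/p(k) ≤ c Σ_k 2^{−(1+α)k}/p(k) =
  (c/r) Σ_k (2^{(1+α)}(1−r))^{−k} < ∞`", "`E[C] = E[C_N] ≤ c' Σ_k 2^k p(k) = r c' Σ_k (2(1−r))^k < ∞`";
  and "the optimal choice of `N` should be geometrically distributed with `r = 1 − 2^{−(1+α/2)}`".

Contents (all proved).
* `sq_sum_sqrt_mul_le` / **`sq_tsum_sqrt_mul_le`** — the Cauchy–Schwarz FLOOR of the work–variance
  product: for every positive tail sequence `F`, `(Σ_n √(β_n t_n))² ≤ (Σ_n β_n/F_n)(Σ_n t_n F_n)`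
  (finite and infinite horizon; in the infinite case the convergence of `Σ √(β_n t_n)` is part of the
  conclusion). [RheeGlynn2015, Prop. 1] via [ZhengPanWang2023, §2 Problem (1), §4].
* `rgLaw β t n = √((β_n/t_n)/(β_0/t_0))` — the Rhee–Glynn law; `rgLaw_zero` (`F*_0 = 1`),
  `rgLaw_pos`, `rgLaw_antitone` (feasible iff `β_n/t_n` is non-increasing), and
  **`RheeGlynn2015_prop_1_finset`** / **`RheeGlynn2015_prop_1`** — `g(F*) = (Σ √(β_n t_n))² ≤ g(F)`
  for every positive `F` (so `F*` is optimal among ALL positive tails, a fortiori among the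
  feasible non-increasing ones). [RheeGlynn2015, Prop. 1]; [ZhengPanWang2023, §4].
* **`geometric_costClass`** — [RheeGlynn2012, §2] / [Vihola2018, §3]: if `β_n ≤ C a^n` and
  `t_n ≤ C' b^n` with `ab < 1`, the geometric tail `F_n = θ^n`, `θ = √(a/b)` (Rhee–Glynn's
  "`γ = (1+2r)/2`", the midpoint in log scale), has BOTH `Σ β_n/F_n < ∞` and `Σ t_n F_n < ∞`;
  `not_summable_of_ge` — conversely if `β_n ≥ c a^n`, `t_n ≥ c' b^n` with `ab ≥ 1` then no positive
  tail makes both series finite (the "`2r > 1`" requirement: `(Σ √(β_n t_n))² = ∞`).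
* **`BlanchetGlynnPei2019_general_principle`** — [BlanchetGlynnPei2019, §2]: with the geometric law
  `p(k) = r(1−r)^k`, `r ∈ (1/2, 1 − 2^{−(1+α)})`, the variance series `Σ E Δ_k²/p(k)` and the cost
  series `Σ E C_k p(k)` are both finite under Assumption 1; `advocated_r_mem` — the advocated
  `r = 1 − 2^{−(1+α/2)}` lies in that interval.

Context (cell pub-lqcd, HOME/R2-SCOPE.md §4 cost classes): an unbiased ("exact-in-expectation")
replacement of a biased truncation — of `tr log`, of a rational approximation, of a multilevel
flow — pays `E(work)·var ≥ (Σ_n √(β_n t_n))²`; the randomization is affordable exactly when the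
squared increments decay faster than the level costs grow.
-/

noncomputable section

namespace Literature.Probability.Moments

namespace WorkVariance

open Finset
open scoped BigOperators Topology

/-! ## The Cauchy–Schwarz floor -/

/-- **CAUCHY–SCHWARZ FLOOR (finite horizon)**: for `β, t ≥ 0` and any positive tail `F`,
`(Σ_{n∈s} √(β_n t_n))² ≤ (Σ_{n∈s} β_n/F_n)(Σ_{n∈s} t_n F_n)`.
[cite: RheeGlynn2015, Proposition 1]; [cite: ZhengPanWang2023, §2 Problem (2) and §4] -/
theorem sq_sum_sqrt_mul_le (s : Finset ℕ) {β t F : ℕ → ℝ} (hβ : ∀ n, 0 ≤ β n) (ht : ∀ n, 0 ≤ t n)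
    (hF : ∀ n, 0 < F n) :
    (∑ n ∈ s, Real.sqrt (β n * t n)) ^ 2 ≤ (∑ n ∈ s, β n / F n) * ∑ n ∈ s, t n * F n := by
  -- the same Cauchy–Schwarz step as Giles' allocation bound (`MLMC.sq_sum_sqrt_le_cost_mul_mlVar`,
  -- levels ↔ tail probabilities), reused rather than re-proved
  calc (∑ n ∈ s, Real.sqrt (β n * t n)) ^ 2 ≤ MLMC.cost s F t * MLMC.mlVar s F β :=
        MLMC.sq_sum_sqrt_le_cost_mul_mlVar s (fun n _ => hβ n) (fun n _ => ht n) (fun n _ => hF n)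
    _ = (∑ n ∈ s, β n / F n) * ∑ n ∈ s, t n * F n := by
        rw [MLMC.cost, MLMC.mlVar, mul_comm]
        congr 1
        exact sum_congr rfl fun n _ => mul_comm _ _

/-- **CAUCHY–SCHWARZ FLOOR (infinite horizon)** — [ZhengPanWang2023, §2 Problem (1)]: if the
variance factor `Σ_n β_n/F_n` and the work factor `Σ_n t_n F_n` both converge for a positive tail
`F`, then `Σ_n √(β_n t_n)` converges and `(Σ_n √(β_n t_n))² ≤ (Σ_n β_n/F_n)(Σ_n t_n F_n)`.
[cite: RheeGlynn2015, Proposition 1]; [cite: ZhengPanWang2023, §2 Problem (1)] -/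
theorem sq_tsum_sqrt_mul_le {β t F : ℕ → ℝ} (hβ : ∀ n, 0 ≤ β n) (ht : ∀ n, 0 ≤ t n)
    (hF : ∀ n, 0 < F n) (hv : Summable fun n => β n / F n) (hw : Summable fun n => t n * F n) :
    Summable (fun n => Real.sqrt (β n * t n)) ∧
      (∑' n, Real.sqrt (β n * t n)) ^ 2 ≤ (∑' n, β n / F n) * ∑' n, t n * F n := by
  set A := ∑' n, β n / F n with hA
  set B := ∑' n, t n * F n with hB
  have hA0 : 0 ≤ A := tsum_nonneg fun n => div_nonneg (hβ n) (hF n).le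
  have hB0 : 0 ≤ B := tsum_nonneg fun n => mul_nonneg (ht n) (hF n).le
  have hpart : ∀ m, ∑ n ∈ range m, Real.sqrt (β n * t n) ≤ Real.sqrt (A * B) := by
    intro m
    have h1 := sq_sum_sqrt_mul_le (range m) hβ ht hF
    have h2 : (∑ n ∈ range m, β n / F n) * ∑ n ∈ range m, t n * F n ≤ A * B :=
      mul_le_mul (hv.sum_le_tsum _ fun n _ => div_nonneg (hβ n) (hF n).le)
        (hw.sum_le_tsum _ fun n _ => mul_nonneg (ht n) (hF n).le)
        (sum_nonneg fun n _ => mul_nonneg (ht n) (hF n).le) hA0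
    have h0 : 0 ≤ ∑ n ∈ range m, Real.sqrt (β n * t n) := sum_nonneg fun n _ => Real.sqrt_nonneg _
    exact (Real.le_sqrt h0 (mul_nonneg hA0 hB0)).mpr (h1.trans h2)
  have hs : Summable fun n => Real.sqrt (β n * t n) :=
    summable_of_sum_range_le (fun n => Real.sqrt_nonneg _) hpart
  refine ⟨hs, ?_⟩
  have hle : ∑' n, Real.sqrt (β n * t n) ≤ Real.sqrt (A * B) :=
    Summable.tsum_le_of_sum_range_le hs hpart
  have h0 : 0 ≤ ∑' n, Real.sqrt (β n * t n) := tsum_nonneg fun n => Real.sqrt_nonneg _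
  calc (∑' n, Real.sqrt (β n * t n)) ^ 2 ≤ Real.sqrt (A * B) ^ 2 := by gcongr
    _ = A * B := Real.sq_sqrt (mul_nonneg hA0 hB0)

/-! ## Proportional tails attain the floor -/

/-- For a tail PROPORTIONAL to `√(β_n/t_n)`, `F_n = c √(β_n/t_n)` (`c > 0`, `t_n > 0`, `β_n ≥ 0`):
`β_n/F_n = √(β_n t_n)/c`. [cite: ZhengPanWang2023, §4 (display for `F̄_i`)] -/
theorem div_propLaw {β t c : ℝ} (hβ : 0 ≤ β) (ht : 0 < t) (hc : 0 < c) :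
    β / (c * Real.sqrt (β / t)) = Real.sqrt (β * t) / c := by
  rcases hβ.eq_or_lt with h0 | hpos
  · rw [← h0]
    simp
  · have hs : Real.sqrt (β / t) ≠ 0 := (Real.sqrt_pos.mpr (div_pos hpos ht)).ne'
    have key : Real.sqrt (β * t) * Real.sqrt (β / t) = β := by
      rw [← Real.sqrt_mul (mul_nonneg hpos.le ht.le),
        show β * t * (β / t) = β * β by field_simp, Real.sqrt_mul_self hpos.le]
    rw [div_eq_div_iff (mul_ne_zero hc.ne' hs) hc.ne']
    calc β * c = (Real.sqrt (β * t) * Real.sqrt (β / t)) * c := by rw [key]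
      _ = Real.sqrt (β * t) * (c * Real.sqrt (β / t)) := by ring

/-- For `F_n = c √(β_n/t_n)`: `t_n F_n = c √(β_n t_n)`. [cite: ZhengPanWang2023, §4] -/
theorem mul_propLaw {β t c : ℝ} (ht : 0 < t) :
    t * (c * Real.sqrt (β / t)) = c * Real.sqrt (β * t) := by
  have ht' : t ≠ 0 := ht.ne'
  have key : t * Real.sqrt (β / t) = Real.sqrt (β * t) := by
    rw [show β * t = t * t * (β / t) by field_simp, Real.sqrt_mul (mul_self_nonneg t),
      Real.sqrt_mul_self ht.le]
  calc t * (c * Real.sqrt (β / t)) = c * (t * Real.sqrt (β / t)) := by ring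
    _ = c * Real.sqrt (β * t) := by rw [key]

/-- A proportional tail ATTAINS the floor on every finite horizon:
`(Σ_{s} β_n/F_n)(Σ_{s} t_n F_n) = (Σ_{s} √(β_n t_n))²` for `F_n = c√(β_n/t_n)`.
[cite: RheeGlynn2015, Proposition 1]; [cite: ZhengPanWang2023, §4] -/
theorem prod_propLaw_eq (s : Finset ℕ) {β t F : ℕ → ℝ} {c : ℝ} (hβ : ∀ n, 0 ≤ β n)
    (ht : ∀ n, 0 < t n) (hc : 0 < c) (hF : ∀ n, F n = c * Real.sqrt (β n / t n)) :
    (∑ n ∈ s, β n / F n) * ∑ n ∈ s, t n * F n = (∑ n ∈ s, Real.sqrt (β n * t n)) ^ 2 := by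
  have e1 : ∀ n, β n / F n = Real.sqrt (β n * t n) / c := fun n => by
    rw [hF n, div_propLaw (hβ n) (ht n) hc]
  have e2 : ∀ n, t n * F n = c * Real.sqrt (β n * t n) := fun n => by
    rw [hF n, mul_propLaw (ht n)]
  simp only [e1, e2, ← sum_div, ← mul_sum]
  field_simp

/-! ## The Rhee–Glynn law and Proposition 1 -/

/-- The RHEE–GLYNN TAIL LAW `F*_n = √((β_n/t_n)/(β_0/t_0))` ("`F̄_i = √((β_i/t_i)/(β_0/t_0))`").
[cite: RheeGlynn2015, Proposition 1]; [cite: ZhengPanWang2023, §4 (display for `F̄_i`)] -/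
def rgLaw (β t : ℕ → ℝ) (n : ℕ) : ℝ :=
  Real.sqrt ((β n / t n) / (β 0 / t 0))

/-- `F*` is the proportional law with constant `c = √(t_0/β_0)`. [cite: ZhengPanWang2023, §4] -/
theorem rgLaw_eq {β t : ℕ → ℝ} (hβ0 : 0 < β 0) (ht0 : 0 < t 0) (n : ℕ) :
    rgLaw β t n = Real.sqrt (t 0 / β 0) * Real.sqrt (β n / t n) := by
  rw [rgLaw, ← Real.sqrt_mul (div_nonneg ht0.le hβ0.le)]
  congr 1
  field_simp

/-- `F*_0 = 1` (the constraint `F_0 = P(N ≥ 0) = 1`). [cite: ZhengPanWang2023, §2 Problem (1)] -/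
theorem rgLaw_zero {β t : ℕ → ℝ} (hβ0 : 0 < β 0) (ht0 : 0 < t 0) : rgLaw β t 0 = 1 := by
  rw [rgLaw, div_self (div_pos hβ0 ht0).ne', Real.sqrt_one]

/-- `F*_n > 0` when `β, t > 0`. [cite: ZhengPanWang2023, §2 Problem (1) (`F_i > 0`)] -/
theorem rgLaw_pos {β t : ℕ → ℝ} (hβ : ∀ n, 0 < β n) (ht : ∀ n, 0 < t n) (n : ℕ) :
    0 < rgLaw β t n :=
  Real.sqrt_pos.mpr (div_pos (div_pos (hβ n) (ht n)) (div_pos (hβ 0) (ht 0)))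

/-- `F*` is FEASIBLE (non-increasing) exactly in the regime of Proposition 1: `β_n/t_n`
non-increasing. [cite: RheeGlynn2015, Proposition 1]; [cite: ZhengPanWang2023, §4 (the blocks
`J` on which `β_i(J)/t_i(J)` decreases)] -/
theorem rgLaw_antitone {β t : ℕ → ℝ} (hβ0 : 0 < β 0) (ht0 : 0 < t 0)
    (hr : Antitone fun n => β n / t n) : Antitone (rgLaw β t) := by
  intro m n hmn
  unfold rgLaw
  exact Real.sqrt_le_sqrt (div_le_div_of_nonneg_right (hr hmn) (div_pos hβ0 ht0).le)

/-- **RHEE–GLYNN 2015, PROPOSITION 1 (finite horizon)**: with `β, t > 0`, on every finite set of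
levels the Rhee–Glynn law attains the Cauchy–Schwarz floor,
`(Σ_s β_n/F*_n)(Σ_s t_n F*_n) = (Σ_s √(β_n t_n))²`, hence is optimal against EVERY positive tail `F`:
`g_s(F*) ≤ g_s(F)`. [cite: RheeGlynn2015, Proposition 1]; [cite: ZhengPanWang2023, §2
Problem (2), §4] -/
theorem RheeGlynn2015_prop_1_finset (s : Finset ℕ) {β t : ℕ → ℝ} (hβ : ∀ n, 0 < β n)
    (ht : ∀ n, 0 < t n) {F : ℕ → ℝ} (hF : ∀ n, 0 < F n) :
    (∑ n ∈ s, β n / rgLaw β t n) * (∑ n ∈ s, t n * rgLaw β t n) =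
        (∑ n ∈ s, Real.sqrt (β n * t n)) ^ 2 ∧
      (∑ n ∈ s, β n / rgLaw β t n) * (∑ n ∈ s, t n * rgLaw β t n) ≤
        (∑ n ∈ s, β n / F n) * ∑ n ∈ s, t n * F n := by
  have heq := prod_propLaw_eq s (fun n => (hβ n).le) ht
    (Real.sqrt_pos.mpr (div_pos (ht 0) (hβ 0))) (rgLaw_eq (hβ 0) (ht 0))
  exact ⟨heq, heq ▸ sq_sum_sqrt_mul_le s (fun n => (hβ n).le) (fun n => (ht n).le) hF⟩

/-- **RHEE–GLYNN 2015, PROPOSITION 1 (infinite horizon)** — the optimisation problem of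
[ZhengPanWang2023, §2 Problem (1)]: let `β, t > 0` and let `F > 0` be any tail with finite variance
factor `Σ β_n/F_n` and finite work factor `Σ t_n F_n`.  Then `Σ √(β_n t_n)` converges, the
Rhee–Glynn law `F*` has finite factors too, its work–variance product is `(Σ_n √(β_n t_n))²`, and
this is `≤ (Σ β_n/F_n)(Σ t_n F_n)`.  (With `β_n/t_n` non-increasing, `F*` is feasible —
`rgLaw_zero`, `rgLaw_antitone` — hence THE minimiser.) [cite: RheeGlynn2015, Proposition 1];
[cite: ZhengPanWang2023, §2 Problem (1) and §4] -/
theorem RheeGlynn2015_prop_1 {β t : ℕ → ℝ} (hβ : ∀ n, 0 < β n) (ht : ∀ n, 0 < t n)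
    {F : ℕ → ℝ} (hF : ∀ n, 0 < F n) (hv : Summable fun n => β n / F n)
    (hw : Summable fun n => t n * F n) :
    Summable (fun n => Real.sqrt (β n * t n)) ∧
      Summable (fun n => β n / rgLaw β t n) ∧ Summable (fun n => t n * rgLaw β t n) ∧
      (∑' n, β n / rgLaw β t n) * (∑' n, t n * rgLaw β t n) = (∑' n, Real.sqrt (β n * t n)) ^ 2 ∧
      (∑' n, Real.sqrt (β n * t n)) ^ 2 ≤ (∑' n, β n / F n) * ∑' n, t n * F n := by
  obtain ⟨hs, hle⟩ := sq_tsum_sqrt_mul_le (fun n => (hβ n).le) (fun n => (ht n).le) hF hv hw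
  set c : ℝ := Real.sqrt (t 0 / β 0) with hc_def
  have hc : 0 < c := Real.sqrt_pos.mpr (div_pos (ht 0) (hβ 0))
  have e1 : ∀ n, β n / rgLaw β t n = Real.sqrt (β n * t n) / c := fun n => by
    rw [rgLaw_eq (hβ 0) (ht 0), div_propLaw (hβ n).le (ht n) hc]
  have e2 : ∀ n, t n * rgLaw β t n = c * Real.sqrt (β n * t n) := fun n => by
    rw [rgLaw_eq (hβ 0) (ht 0), mul_propLaw (ht n)]
  simp only [e1, e2]
  refine ⟨hs, hs.div_const c, hs.mul_left c, ?_, hle⟩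
  rw [tsum_div_const, tsum_mul_left]
  field_simp

/-! ## The geometric cost class -/

/-- **THE GEOMETRIC COST CLASS** — [RheeGlynn2012, §2 (last paragraph)] / [Vihola2018, §3]: if the
variance terms decay geometrically, `0 ≤ β_n ≤ C a^n`, and the level costs grow geometrically,
`0 ≤ t_n ≤ C' b^n`, with `ab < 1` (Rhee–Glynn: `β_n = O(2^{−2rn})`, `t_n = 2^{n−1}`, "`2r > 1`"),
then the geometric tail `F_n = θ^n` with `θ = √(a/b)` (the log-midpoint, Rhee–Glynn's
"`γ = (1+2r)/2`") makes BOTH factors finite: `Σ β_n/θ^n < ∞` and `Σ t_n θ^n < ∞`.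
[cite: RheeGlynn2012, §2 (last paragraph)]; [cite: Vihola2018, §3 (paragraph after Remark 6)] -/
theorem geometric_costClass {β t : ℕ → ℝ} {a b C C' : ℝ} (ha : 0 < a) (hb : 0 < b)
    (hab : a * b < 1) (hβ : ∀ n, 0 ≤ β n ∧ β n ≤ C * a ^ n) (ht : ∀ n, 0 ≤ t n ∧ t n ≤ C' * b ^ n) :
    0 < Real.sqrt (a / b) ∧
      Summable (fun n => β n / Real.sqrt (a / b) ^ n) ∧
      Summable (fun n => t n * Real.sqrt (a / b) ^ n) := by
  set θ := Real.sqrt (a / b) with hθ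
  have hθpos : 0 < θ := Real.sqrt_pos.mpr (div_pos ha hb)
  set ρ := Real.sqrt (a * b) with hρ
  have hρ0 : 0 ≤ ρ := Real.sqrt_nonneg _
  have hρ1 : ρ < 1 := by
    rw [hρ, show (1 : ℝ) = Real.sqrt 1 by rw [Real.sqrt_one]]
    exact Real.sqrt_lt_sqrt (mul_nonneg ha.le hb.le) hab
  -- `a/θ = ρ` and `bθ = ρ`
  have hθsq : θ ^ 2 = a / b := Real.sq_sqrt (div_nonneg ha.le hb.le)
  have hρsq : ρ ^ 2 = a * b := Real.sq_sqrt (mul_nonneg ha.le hb.le)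
  have h1 : a / θ = ρ := by
    have : (a / θ) ^ 2 = ρ ^ 2 := by
      rw [div_pow, hθsq, hρsq]
      field_simp
    have h0 : 0 ≤ a / θ := div_nonneg ha.le hθpos.le
    nlinarith [sq_nonneg (a / θ - ρ), sq_nonneg (a / θ + ρ)]
  have h2 : b * θ = ρ := by
    have : (b * θ) ^ 2 = ρ ^ 2 := by
      rw [mul_pow, hθsq, hρsq]
      field_simp
    have h0 : 0 ≤ b * θ := mul_nonneg hb.le hθpos.le
    nlinarith [sq_nonneg (b * θ - ρ), sq_nonneg (b * θ + ρ)]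
  have hgeo : Summable fun n : ℕ => ρ ^ n := summable_geometric_of_lt_one hρ0 hρ1
  have hC : 0 ≤ C := by
    have := (hβ 0).1.trans (hβ 0).2
    simpa using this
  have hC' : 0 ≤ C' := by
    have := (ht 0).1.trans (ht 0).2
    simpa using this
  refine ⟨hθpos, ?_, ?_⟩
  · refine Summable.of_nonneg_of_le (fun n => div_nonneg (hβ n).1 (pow_nonneg hθpos.le n))
      (fun n => ?_) (hgeo.mul_left C)
    calc β n / θ ^ n ≤ C * a ^ n / θ ^ n :=
          div_le_div_of_nonneg_right (hβ n).2 (pow_nonneg hθpos.le n)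
      _ = C * (a / θ) ^ n := by rw [div_pow, mul_div_assoc]
      _ = C * ρ ^ n := by rw [h1]
  · refine Summable.of_nonneg_of_le (fun n => mul_nonneg (ht n).1 (pow_nonneg hθpos.le n))
      (fun n => ?_) (hgeo.mul_left C')
    calc t n * θ ^ n ≤ C' * b ^ n * θ ^ n :=
          mul_le_mul_of_nonneg_right (ht n).2 (pow_nonneg hθpos.le n)
      _ = C' * (b * θ) ^ n := by rw [mul_pow, mul_assoc]
      _ = C' * ρ ^ n := by rw [h2]

/-- **THE CONVERSE ("`2r > 1` is required")** — [RheeGlynn2012, §2]: if `β_n ≥ c a^n` and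
`t_n ≥ c' b^n` with `c, c' > 0` and `ab ≥ 1`, then `√(β_n t_n) ≥ √(cc') (ab)^{n/2} ≥ √(cc')` does
not tend to `0`, so `Σ √(β_n t_n) = ∞` and, by the Cauchy–Schwarz floor, NO positive tail `F` has
both `Σ β_n/F_n < ∞` and `Σ t_n F_n < ∞`. [cite: RheeGlynn2012, §2 (last paragraph: "we require
that `γ > 1` … ensured when `2r > 1`")] -/
theorem not_summable_of_ge {β t : ℕ → ℝ} {a b c c' : ℝ} (ha : 0 < a) (hb : 0 < b)
    (hab : 1 ≤ a * b) (hc : 0 < c) (hc' : 0 < c') (hβ : ∀ n, c * a ^ n ≤ β n)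
    (ht : ∀ n, c' * b ^ n ≤ t n) {F : ℕ → ℝ} (hF : ∀ n, 0 < F n) :
    ¬ (Summable (fun n => β n / F n) ∧ Summable (fun n => t n * F n)) := by
  rintro ⟨hv, hw⟩
  have hβ0 : ∀ n, 0 ≤ β n := fun n => (mul_nonneg hc.le (pow_nonneg ha.le n)).trans (hβ n)
  have ht0 : ∀ n, 0 ≤ t n := fun n => (mul_nonneg hc'.le (pow_nonneg hb.le n)).trans (ht n)
  obtain ⟨hs, -⟩ := sq_tsum_sqrt_mul_le hβ0 ht0 hF hv hw
  have hlim := hs.tendsto_atTop_zero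
  -- but `√(β_n t_n) ≥ √(c c')` for all `n`
  have hlow : ∀ n, Real.sqrt (c * c') ≤ Real.sqrt (β n * t n) := by
    intro n
    refine Real.sqrt_le_sqrt ?_
    calc c * c' ≤ c * c' * (a * b) ^ n := le_mul_of_one_le_right (mul_nonneg hc.le hc'.le)
          (one_le_pow₀ hab)
      _ = (c * a ^ n) * (c' * b ^ n) := by rw [mul_pow]; ring
      _ ≤ β n * t n := mul_le_mul (hβ n) (ht n) (mul_nonneg hc'.le (pow_nonneg hb.le n)) (hβ0 n)
  have hpos : 0 < Real.sqrt (c * c') := Real.sqrt_pos.mpr (mul_pos hc hc')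
  have hev := (hlim.eventually (gt_mem_nhds hpos)).exists
  obtain ⟨n, hn⟩ := hev
  exact (not_lt.mpr (hlow n)) hn

/-! ## The single-term estimator with a geometric level (Blanchet–Glynn–Pei's general principle) -/

/-- **BLANCHET–GLYNN–PEI 2019, §2 (THE GENERAL PRINCIPLE)**: under Assumption 1 — second moments
`0 ≤ v_k ≤ c·2^{−(1+α)k}` (`v_k = E Δ_k²`) and costs `0 ≤ C_k ≤ c'·2^k` — and a GEOMETRIC level
`p(k) = r(1−r)^k` with `r ∈ (1/2, 1 − 2^{−(1+α)})`, both the variance series `Σ_k v_k/p(k)` of the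
single-term estimator `Z = Δ_N/p(N)` ("`E[Z²] = Σ_k E[Δ_k²]/p(k) ≤ … < ∞`") and its expected cost
`Σ_k C_k p(k)` ("`E[C] ≤ c' Σ_k 2^k p(k) = r c' Σ_k (2(1−r))^k < ∞`") are finite.
[cite: BlanchetGlynnPei2019, §2 (Assumption 1 and the displays (eA), (eC))] -/
theorem BlanchetGlynnPei2019_general_principle {α c c' r : ℝ} {v C : ℕ → ℝ}
    (hr1 : 1 / 2 < r) (hr2 : r < 1 - (2 : ℝ) ^ (-(1 + α)))
    (hv : ∀ k, 0 ≤ v k ∧ v k ≤ c * (2 : ℝ) ^ (-(1 + α) * k))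
    (hC : ∀ k, 0 ≤ C k ∧ C k ≤ c' * 2 ^ k) :
    (∀ k, 0 < r * (1 - r) ^ k) ∧
      Summable (fun k => v k / (r * (1 - r) ^ k)) ∧ Summable (fun k => C k * (r * (1 - r) ^ k)) := by
  have h2pos : 0 < (2 : ℝ) ^ (-(1 + α)) := Real.rpow_pos_of_pos two_pos _
  have hr0 : 0 < r := by linarith
  have h1r : 0 < 1 - r := by linarith
  have hp : ∀ k, 0 < r * (1 - r) ^ k := fun k => mul_pos hr0 (pow_pos h1r k)
  have hc : 0 ≤ c := by
    have := (hv 0).1.trans (hv 0).2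
    simpa using this
  have hc' : 0 ≤ c' := by
    have := (hC 0).1.trans (hC 0).2
    simpa using this
  refine ⟨hp, ?_, ?_⟩
  · -- ratio `ρ = 2^{−(1+α)}/(1−r) < 1`
    set ρ : ℝ := (2 : ℝ) ^ (-(1 + α)) / (1 - r) with hρ
    have hρ0 : 0 ≤ ρ := div_nonneg h2pos.le h1r.le
    have hρ1 : ρ < 1 := by rw [hρ, div_lt_one h1r]; linarith
    have hgeo : Summable fun k : ℕ => ρ ^ k := summable_geometric_of_lt_one hρ0 hρ1
    refine Summable.of_nonneg_of_le (fun k => div_nonneg (hv k).1 (hp k).le) (fun k => ?_)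
      (hgeo.mul_left (c / r))
    have e : (2 : ℝ) ^ (-(1 + α) * k) = ((2 : ℝ) ^ (-(1 + α))) ^ k := by
      rw [Real.rpow_mul (by norm_num : (0 : ℝ) ≤ 2), Real.rpow_natCast]
    calc v k / (r * (1 - r) ^ k) ≤ c * (2 : ℝ) ^ (-(1 + α) * k) / (r * (1 - r) ^ k) :=
          div_le_div_of_nonneg_right (hv k).2 (hp k).le
      _ = c / r * ρ ^ k := by
          rw [e, hρ, div_pow]
          field_simp
  · -- ratio `2(1−r) < 1`
    set ρ : ℝ := 2 * (1 - r) with hρ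
    have hρ0 : 0 ≤ ρ := by rw [hρ]; positivity
    have hρ1 : ρ < 1 := by rw [hρ]; linarith
    have hgeo : Summable fun k : ℕ => ρ ^ k := summable_geometric_of_lt_one hρ0 hρ1
    refine Summable.of_nonneg_of_le (fun k => mul_nonneg (hC k).1 (hp k).le) (fun k => ?_)
      (hgeo.mul_left (c' * r))
    calc C k * (r * (1 - r) ^ k) ≤ c' * 2 ^ k * (r * (1 - r) ^ k) :=
          mul_le_mul_of_nonneg_right (hC k).2 (hp k).le
      _ = c' * r * ρ ^ k := by rw [hρ, mul_pow]; ring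

/-- The ADVOCATED parameter `r = 1 − 2^{−(1+α/2)}` (the log-midpoint, cf. `geometric_costClass`)
lies in `(1/2, 1 − 2^{−(1+α)})` for `α > 0`. [cite: BlanchetGlynnPei2019, §2 ("the optimal choice
of `N` should be geometrically distributed with `r = 1 − 2^{−(1+α/2)}`")] -/
theorem advocated_r_mem {α : ℝ} (hα : 0 < α) :
    1 / 2 < 1 - (2 : ℝ) ^ (-(1 + α / 2)) ∧
      1 - (2 : ℝ) ^ (-(1 + α / 2)) < 1 - (2 : ℝ) ^ (-(1 + α)) := by
  have h1 : (2 : ℝ) ^ (-(1 + α / 2)) < (2 : ℝ) ^ (-(1 : ℝ)) :=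
    Real.rpow_lt_rpow_of_exponent_lt (by norm_num) (by linarith)
  have h2 : (2 : ℝ) ^ (-(1 + α)) < (2 : ℝ) ^ (-(1 + α / 2)) :=
    Real.rpow_lt_rpow_of_exponent_lt (by norm_num) (by linarith)
  have h3 : (2 : ℝ) ^ (-(1 : ℝ)) = 1 / 2 := by
    rw [Real.rpow_neg (by norm_num), Real.rpow_one]
    norm_num
  constructor <;> linarith


end WorkVariance

end Literature.Probability.Moments
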